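import Literature.Geometry.Lorentzian.CurvatureNaturality
import Literature.Geometry.Lorentzian.IsometryProofs
import Literature.Geometry.Lorentzian.LeviCivitaProofs
import Literature.Geometry.Manifold.SmoothEmbeddingInverse
import Mathlib.Geometry.Manifold.Diffeomorph
import HarnessLib

/-!
# Transporting a metric along a local diffeomorphism: open pieces of a glued manifold,
# diffeomorphic models

Topic `Literature/Geometry/Riemannian` (namespace `Literature.Geometry.Riemannian`). Layer L7
(transport) of the proof programme of the named fact
`Literature.Geometry.Riemannian.BaerHankePscGluing` (`BaerHankeGluing.lean`; Bär–Hanke,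
*Boundary conditions for scalar curvature*, §4.4, Thm. 42). Two transports occur there:
(a) in `M̂ = M₁ ∪_Σ M₂` the smooth metric on `M̂` coincides, away from the seam `Σ`, with the given
metrics of the pieces — in the tree's relational vocabulary (`IsBoundaryGluing`: smooth
embeddings `jM : M → P`, `jN : N → P`) "the metric `gM` regarded as a metric on the open subset
`jM(M) ∖ Σ` of `P`" is the pullback of `gM` along the smooth inverse `jM⁻¹ : U → M` on an open
`U ⊆ range jM` (`Literature.Geometry.Manifold.contMDiff_invFun_comp_subtype_val`,
`injective_mfderiv_invFun_comp_subtype_val`); (b) Bär–Hanke's smooth structure on `M̂` near `Σ`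
is the one induced by the geodesic collars of the metrics (§3, "the normal exponential map …
induces a smooth structure on the double"), so for a FIXED smooth `P` the glued metric is first
obtained on a diffeomorphic model and then moved to `P` along a diffeomorphism. Both are
instances of pulling back along a smooth map with injective differential between manifolds on
the same model space (`PseudoRiemannianMetric.comap`), which keeps the Levi-Civita connection,
Riemannian-ness and the scalar curvature (`scalarCurvature_comap`, O'Neill 1983, Ch. 3,
Prop. 3.59):

* `exists_metric_comap_of_injective` — the transported metric along any smooth `Ψ : Q → M` with
  injective differential: value, Riemannian-ness, `S(u) = S_g(Ψ u)`;
* `exists_pscMetric_comap_of_injective` — positive scalar curvature passes along `Ψ`;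
* `exists_metric_on_openPiece`, `exists_pscMetric_on_openPiece` — case (a), `Ψ = jM⁻¹` on an
  open `U ⊆ range jM`;
* `exists_pscMetric_of_diffeomorph` — case (b), `Ψ = e.symm` for a diffeomorphism `e : Q ≃ₘ P`.

Everything is proved; no definitions and no named facts are introduced.

## References

* C. Bär, B. Hanke, *Boundary conditions for scalar curvature*, arXiv:2012.09127, §3 (smooth
  structure on the double from the normal exponential map), §4.4 (`g_j = g|_{M_j}`). [BarHanke2023]
* B. O'Neill, *Semi-Riemannian geometry* (1983), Ch. 3, Prop. 3.59 (local isometries preserve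
  curvature). [ONeill1983]
-/

open scoped Manifold ContDiff Topology
open Set Function

noncomputable section

namespace Literature.Geometry.Riemannian

open Literature.Geometry.Lorentzian Literature.Geometry.Manifold

universe u

variable {E : Type u} [NormedAddCommGroup E] [NormedSpace ℝ E] [FiniteDimensional ℝ E]
  [CompleteSpace E]
  {H : Type*} [TopologicalSpace H] {I : ModelWithCorners ℝ E H}
  {H' : Type*} [TopologicalSpace H'] {J : ModelWithCorners ℝ E H'}
  {M : Type*} [TopologicalSpace M] [ChartedSpace H M] [IsManifold I ∞ M]
  {Q : Type*} [TopologicalSpace Q] [ChartedSpace H' Q] [IsManifold J ∞ Q]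

/-! ### Transport along a smooth map with injective differential -/

/-- **Transport of a metric along a local diffeomorphism.** For a smooth map `Ψ : Q → M` with
injective differential between manifolds on the same model vector space `E` (a local
diffeomorphism onto an open set: an open embedding, the inverse of an embedding on its range, a
diffeomorphism, a covering) and a smooth pseudo-Riemannian metric `g` on `M` with its
Levi-Civita connection, the pullback `Ψ^* g` (`PseudoRiemannianMetric.comap`) is a smooth
metric on `Q` with its Levi-Civita connection, with `(Ψ^*g)_u(v, w) = g_{Ψ u}(dΨ v, dΨ w)`,
Riemannian if `g` is, and with scalar curvature `S_{Ψ^*g}(u) = S_g(Ψ u)` (O'Neill 1983, Ch. 3,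
Prop. 3.59). [cite: ONeill1983, Ch. 3, Prop. 3.59] -/
theorem exists_metric_comap_of_injective {Ψ : Q → M} (hΨ : ContMDiff J I ∞ Ψ)
    (hΨ' : ∀ u, Function.Injective (mfderiv J I Ψ u))
    (g : PseudoRiemannianMetric I ∞ E (TangentSpace I : M → Type _)) [g.HasLeviCivita] :
    ∃ gQ : PseudoRiemannianMetric J ∞ E (TangentSpace J : Q → Type _), ∃ _ : gQ.HasLeviCivita,
      (∀ (u : Q) (v w : TangentSpace J u), gQ.val u v w =
        g.val (Ψ u) (mfderiv J I Ψ u v) (mfderiv J I Ψ u w)) ∧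
      (g.IsRiemannian → gQ.IsRiemannian) ∧
      (∀ u : Q, gQ.scalarCurvature u = g.scalarCurvature (Ψ u)) := by
  have hΨ1 : ContMDiff J I (∞ + 1) Ψ := by
    have h : ((∞ : ℕ∞ω) + 1) = ∞ := rfl
    rw [h]
    exact hΨ
  set gQ := g.comap PseudoRiemannianMetric.contMDiff_pullbackBilin_holds Ψ hΨ1 hΨ' rfl with hgQ
  haveI hLC : gQ.HasLeviCivita := gQ.hasLeviCivita
  refine ⟨gQ, hLC, fun u v w ↦ rfl, fun hg ↦ ?_, fun u ↦ ?_⟩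
  · intro u v hv
    simp only [hgQ, PseudoRiemannianMetric.val_comap, pullbackBilin_apply]
    exact hg (Ψ u) _ fun h0 ↦ hv (hΨ' u (by rw [map_zero]; exact h0))
  · exact g.scalarCurvature_comap PseudoRiemannianMetric.contMDiff_pullbackBilin_holds
      hΨ1 hΨ' rfl u

/-- **Positive scalar curvature passes along a local diffeomorphism**: with `Ψ` as in
`exists_metric_comap_of_injective`, if `g` is Riemannian with `S_g > 0` on the image of `Ψ`
then `Q` carries a smooth Riemannian metric, with Levi-Civita connection, of positive scalar
curvature (`Ψ^* g`). [cite: ONeill1983, Ch. 3, Prop. 3.59] -/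
theorem exists_pscMetric_comap_of_injective {Ψ : Q → M} (hΨ : ContMDiff J I ∞ Ψ)
    (hΨ' : ∀ u, Function.Injective (mfderiv J I Ψ u))
    (g : PseudoRiemannianMetric I ∞ E (TangentSpace I : M → Type _)) [g.HasLeviCivita]
    (hg : g.IsRiemannian) (hS : ∀ u : Q, 0 < g.scalarCurvature (Ψ u)) :
    ∃ gQ : PseudoRiemannianMetric J ∞ E (TangentSpace J : Q → Type _), ∃ _ : gQ.HasLeviCivita,
      gQ.IsRiemannian ∧ ∀ u : Q, 0 < gQ.scalarCurvature u := by
  obtain ⟨gQ, hLC, -, hR, hSc⟩ := exists_metric_comap_of_injective hΨ hΨ' g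
  exact ⟨gQ, hLC, hR hg, fun u ↦ (hSc u).symm ▸ hS u⟩

/-! ### (a) The open pieces of a glued manifold -/

variable {P : Type*} [TopologicalSpace P] [ChartedSpace H' P] [IsManifold J ∞ P]

/-- **A metric of a piece, transported to an open piece of the glued manifold.** Let
`jM : M → P` be a smooth embedding (`M`, `P` manifolds on the same model vector space `E`, e.g.
`M` a compact piece with boundary, model `𝓡∂ m`, of a boundaryless `P`, model `𝓡 m`), `g` a
smooth pseudo-Riemannian metric on `M` with its Levi-Civita connection, and `U ⊆ range jM` an open
subset of `P`. Then the open submanifold `U` carries the smooth metric `gU = (jM⁻¹)^* g`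
(transport along `jM⁻¹ = invFun jM ∘ Subtype.val : U → M`, smooth with injective differential),
with its Levi-Civita connection, with `gU_u(v, w) = g_{jM⁻¹ u}(d(jM⁻¹) v, d(jM⁻¹) w)`, Riemannian
if `g` is, and with `S_{gU}(u) = S_g(jM⁻¹ u)`. This is "`g_j = g|_{M_j}` away from `Σ`" of
Bär–Hanke §4.4 in the tree's vocabulary. [cite: BarHanke2023, §4.4] -/
theorem exists_metric_on_openPiece [Nonempty M] {jM : M → P}
    (hjM : Manifold.IsSmoothEmbedding I J ∞ jM)
    (g : PseudoRiemannianMetric I ∞ E (TangentSpace I : M → Type _)) [g.HasLeviCivita]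
    (U : TopologicalSpace.Opens P) (hU : (U : Set P) ⊆ range jM) :
    ∃ gU : PseudoRiemannianMetric J ∞ E (TangentSpace J : U → Type _), ∃ _ : gU.HasLeviCivita,
      (∀ (u : U) (v w : TangentSpace J u), gU.val u v w =
        g.val (invFun jM u) (mfderiv J I (invFun jM ∘ (Subtype.val : U → P)) u v)
          (mfderiv J I (invFun jM ∘ (Subtype.val : U → P)) u w)) ∧
      (g.IsRiemannian → gU.IsRiemannian) ∧
      (∀ u : U, gU.scalarCurvature u = g.scalarCurvature (invFun jM u)) :=
  exists_metric_comap_of_injective (contMDiff_invFun_comp_subtype_val hjM hU)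
    (injective_mfderiv_invFun_comp_subtype_val hjM (by simp) hU) g

/-- **Positive scalar curvature of a piece passes to the open piece of the glued manifold**:
with the notation of `exists_metric_on_openPiece`, if `g` is Riemannian with `S_g > 0` on `M`
then the open submanifold `U ⊆ range jM` of `P` carries a smooth Riemannian metric (with
Levi-Civita connection) of positive scalar curvature, namely `(jM⁻¹)^* g`. In the proof of
Bär–Hanke, Thm. 42 (§4.4) this is the part of the glued metric away from the seam.
[cite: BarHanke2023, §4.4] -/
theorem exists_pscMetric_on_openPiece [Nonempty M] {jM : M → P}
    (hjM : Manifold.IsSmoothEmbedding I J ∞ jM)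
    (g : PseudoRiemannianMetric I ∞ E (TangentSpace I : M → Type _)) [g.HasLeviCivita]
    (hg : g.IsRiemannian) (hS : ∀ x, 0 < g.scalarCurvature x)
    (U : TopologicalSpace.Opens P) (hU : (U : Set P) ⊆ range jM) :
    ∃ gU : PseudoRiemannianMetric J ∞ E (TangentSpace J : U → Type _), ∃ _ : gU.HasLeviCivita,
      gU.IsRiemannian ∧ ∀ u : U, 0 < gU.scalarCurvature u :=
  exists_pscMetric_comap_of_injective (contMDiff_invFun_comp_subtype_val hjM hU)
    (injective_mfderiv_invFun_comp_subtype_val hjM (by simp) hU) g hg fun _ ↦ hS _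

/-! ### (b) Diffeomorphic models -/

omit [FiniteDimensional ℝ E] [CompleteSpace E] [IsManifold I ∞ M] [IsManifold J ∞ Q] in
/-- The differential of the inverse of a `C^∞` diffeomorphism is injective (it is inverted by
the differential of the diffeomorphism: chain rule on `e ∘ e.symm = id`). [folklore] -/
theorem injective_mfderiv_diffeomorph_symm (e : Q ≃ₘ⟮J, I⟯ M) (x : M) :
    Function.Injective (mfderiv I J e.symm x) := by
  have hd1 : MDifferentiableAt J I e (e.symm x) :=
    (e.contMDiff (e.symm x)).mdifferentiableAt (by simp)
  have hd2 : MDifferentiableAt I J e.symm x := (e.symm.contMDiff x).mdifferentiableAt (by simp)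
  have hcomp : (e : Q → M) ∘ (e.symm : M → Q) = id := funext fun y ↦ e.apply_symm_apply y
  have hchain : mfderiv I I ((e : Q → M) ∘ (e.symm : M → Q)) x =
      (mfderiv J I e (e.symm x)).comp (mfderiv I J e.symm x) := mfderiv_comp x hd1 hd2
  rw [hcomp, mfderiv_id] at hchain
  have hleft : ∀ z : TangentSpace I x,
      (mfderiv J I e (e.symm x)) ((mfderiv I J e.symm x) z) = z :=
    fun z ↦ (DFunLike.congr_fun hchain z).symm
  intro v w hvw
  rw [← hleft v, ← hleft w, hvw]

/-- **A PSC metric moves along a diffeomorphism**: if `Q` carries a smooth Riemannian metric of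
positive scalar curvature (with Levi-Civita connection) and `e : Q ≃ₘ P` is a diffeomorphism of
manifolds on the same model, then so does `P` (pull back along `e.symm`). In the proof
programme of `BaerHankePscGluing` this moves the glued metric from the geodesic-collar model of
`M ∪_Σ N` (Bär–Hanke §3) to the given `P`. [cite: BarHanke2023, §3 and §4.4] -/
theorem exists_pscMetric_of_diffeomorph (e : Q ≃ₘ⟮J, J⟯ P)
    (gQ : PseudoRiemannianMetric J ∞ E (TangentSpace J : Q → Type _)) [gQ.HasLeviCivita]
    (hg : gQ.IsRiemannian) (hS : ∀ u, 0 < gQ.scalarCurvature u) :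
    ∃ gP : PseudoRiemannianMetric J ∞ E (TangentSpace J : P → Type _), ∃ _ : gP.HasLeviCivita,
      gP.IsRiemannian ∧ ∀ p : P, 0 < gP.scalarCurvature p :=
  exists_pscMetric_comap_of_injective e.symm.contMDiff (injective_mfderiv_diffeomorph_symm e)
    gQ hg fun _ ↦ hS _

end Literature.Geometry.Riemannian

end
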